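import Mathlib.Algebra.Polynomial.Eval.Defs
import Mathlib.Algebra.Polynomial.Degree.Defs
import Mathlib.Data.ZMod.Basic
import Mathlib.RingTheory.Polynomial.Basic
import HarnessLib

/-!
# Barrier catalogue `Parity`: the Möbius (parity) bias of Bateman–Horn over `𝔽_q[u]`

Catalogue entry (D-0021) for the summit `Parity` (sub-problem `BatemanHorn`). Conrad, Conrad and
Gross (2008) showed that the literal function-field analogue of the Bateman–Horn conjecture —
for a prime `f(T) ∈ κ[u][T]` without local obstruction, `κ` a finite field with `q` elements,
`#{g ∈ κ[u] : deg g = n, f(g) prime} ∼ C(f) (q − 1) qⁿ / (deg_T f · log qⁿ)` with the purely LOCAL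
constant `C(f) = log q · ∏_{v ≠ ∞} (1 − ω_f(v)/q_v)/(1 − 1/q_v)` — is "not generally true when
`f(T)` is a polynomial in `T^p`" (`p = char κ`): for such `f` the Möbius values `μ(f(g))` are
PERIODIC in `g` (determined, for `deg g` large, by `g mod M`, `deg g mod 4` and the quadratic
character of the leading coefficient of `g`; Theorem 4.8), so the non-zero values of `μ(f(g))`
need not be equally often `+1` and `−1`; since `μ(f(g)) = +1` forces `f(g)` (square-free, of
degree `> 1`) to be composite, this is a GLOBAL "parity" obstruction to prime values that no
local condition detects. Their corrected Conjecture 6.2 multiplies the naive prediction by a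
Möbius-average factor `Λ_κ(f; n) ∈ [0, 2]`.

* `FunctionFieldMobiusBias` — the named fact, Example 6.10 as printed (a theorem): for
  `f(T) = T⁹ + (2u² + u)T⁶ + (2u + 2)T³ + u² + 2u + 1 ∈ 𝔽₃[u][T]` (prime, no local
  obstruction; the polynomial of Example 1.2), `f(g)` is composite in `𝔽₃[u]` for EVERY
  `g ∈ 𝔽₃[u]` with `deg g ≡ 1 (mod 4)` — whereas the naive analogue predicts
  `≍ 3ⁿ/n` prime values in each degree `n`. The block sits in its docstring.
* `ccgPoly` — the polynomial `f` as an element of `𝔽₃[u][T]` (`Polynomial (Polynomial (ZMod 3))`,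
  inner variable `u`, outer variable `T`), with the unfolding lemma `ccgPoly_eval`.
* `ccgPoly_noLocalObstruction`, `isUnit_of_forall_dvd_ccgPoly_eval` — the Bateman–Horn hypothesis
  "no fixed prime divisor" holds VERBATIM for `f` over `𝔽₃[u]` (PROVED: `f(0) + u·f(1) = 1`), so
  the naive heuristic really is fed its own hypotheses by this example (audit 2026-08-16).

The proof in print rests on the discriminant formula `μ_{κ[u]}(h) = (−1)^{deg h} χ(disc h)`
(Swan; CCG (2.5)), a resultant computation ((3.8)–(3.9)) and quasi-periodicity of resultants.
The fact was vendored when Mathlib had no parity-of-factorisation / Stickelberger–Swan theorem for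
`𝔽_q[u]`; it has since been PROVED in the sibling file `FunctionFieldMobiusBiasProofs.lean`
(`Literature.Barriers.Parity.FunctionFieldMobiusBias_holds`: the special case of Stickelberger–Swan
needed, via Frobenius acting on a Vandermonde determinant, plus the resultant identity (3.8)).

## Audit 2026-08-16 (barrier audit, D-0021): fact CONFIRMED and proved; technique class NARROWED; bite sharpened

1. **Status.** The Lean statement is Example 6.10 exactly as printed — "f(g) is composite in
   `F₃[u]` whenever `g ∈ F₃[u]` satisfies `deg g ≡ 1 mod 4`" (p. 2903 = arXiv p. 37), resting on
   (6.4) = (3.9), which is stated for `n = deg g ≥ 1` (no hidden "degree large" proviso: the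
   `sufficiently large degrees` of Theorem 4.8 is needed only for general `f`) — and it is now a
   theorem of the tree. Theorem 4.8 as printed (p. 15): `κ` of odd characteristic `p`,
   `f ∈ κ[u][T^p]` squarefree in `κ[u][T]`, `f ∉ κ`; modulus `M = M_f^geom`; `n₁, n₂` sufficiently
   large depending only on `deg_{u,T} f` and `deg M`; the `mod 4` condition relaxes to `mod 2` when
   `−1` is a square in `κ` or `deg_T f` is even.
2. **Technique class narrowed.** What the printed argument refutes is the VERBATIM transfer of the
   naive random model to INSEPARABLE `f` over `κ[u]`; it says nothing against the function-field
   analogy for `f` separable over `κ(u)`, which CCG themselves expect to be exact (Remark 6.3,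
   p. 34: "we expect `f(g)` to be prime as often as analogies between `Z` and `κ[u]` predict") and
   which is by now partly PROVED: in the large-`q` limit for every separable system (Entin 2016,
   Theorem 1.1), and at FIXED `q` for twin primes (Sawin–Shusterman, Annals 2022, Theorem 1.1,
   `q > 685090 p²`), for the quadratic Bateman–Horn conjecture (Sawin–Shusterman, Invent. Math.
   2022, Theorem 1.2, `q > 2¹⁰3²e²p⁴`) and for Chowla along the values of ANY separable `F` of
   degree `k` (ibid. Theorem 1.3, `q > 4e²k²p²`). The former bare class token `transfer` (which
   made e.g. Selmer-parity "root-number transfer" routes answer to this entry) is replaced by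
   `verbatim-transfer`; `function-field-analogy` / `function-field-pilot` stay, so that FF pilots
   state on which side of the separable/inseparable line they sit (one line suffices).
3. **The mechanism is double-edged (evasion (c)).** The parity-breaking lever of the fixed-`q`
   theorems above IS the phenomenon of this entry: "for any fixed polynomial `r`, the function
   `μ(r + s^p)` essentially equals `χ_{D_r}(s + c_r)` where `χ_{D_r}` is a quadratic Dirichlet
   character … This observation is very closely related to … [CCG08, Theorem 4.8]"
   (Sawin–Shusterman 2018/2022, p. 3), in substance CCG periodicity for the polynomial
   `F(r + S^p) ∈ κ[u][S^p]`; Möbius periodicity along the cosets `r + κ[u]^p` is universal over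
   `κ[u]`, and becomes an obstruction only when `f` is itself inseparable, so that all of `κ[u]` is
   one coset and the bias survives the average over `r`.
4. **The bite is wider than "local densities".** Besides irreducibility, the absence of a fixed
   prime divisor (now kernel-checked) and the singular series, also the Type-I (congruence) input
   of sieve methods transfers verbatim and even EXACTLY: for `d ≠ 0`, `deg d ≤ n` and any `r`,
   `#{g : deg g = n, g ≡ r (mod d)} = (q−1)q^{n−deg d}` (division algorithm), hence
   `#{g : deg g = n, d ∣ f(g)} = ρ_f(d)(q−1)q^{n−deg d}` with ZERO remainder up to level `q^n`
   (folklore). So `f = ccgPoly` over `𝔽₃[u]` is an honest Bateman–Horn instance with perfect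
   dimension-one sieve data whose prime count is `0` in degrees `≡ 1 (mod 4)` (proved) and,
   conjecturally (Λ = 2, Example 6.10), twice the naive prediction in degrees `≡ 3 (mod 4)` — the
   two extremes `Λ ∈ {0, 2}` of the parity ambiguity of the linear sieve (compare
   `Literature.Barriers.Parity.SelbergParityBarrier`, whose extremal sequences over `ℤ` are
   Selberg's artificial `1 ∓ λ(n)` weights) realised by polynomial values. Use as a litmus test:
   an argument towards `BatemanHorn` every step of which survives for `ccgPoly` over `𝔽₃[u]` is
   wrong; the steps that may legitimately fail there are those using `f′ ≢ 0` / characteristic `0`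
   (e.g. bilinear decompositions along fixed-derivative families) or the archimedean place.
5. **Two subtleties of scope** (now in `scope_caveats`): for THIS `f` the unconditioned non-zero
   values of `μ(f(g))` in each degree `n ≥ 1` are equally often `±1` (`Λ_{κ,1}(f; n) = 1`,
   Example 6.10, p. 37) — the void comes from the coupling of parity with the local condition
   `(f(g), (u−1)(u−2)) = 1`, i.e. from parity being a deterministic function of
   `(g mod M, deg g mod 4, χ(lead g))`, not from a global surplus of `μ = +1`; and the bias is
   generically a small-field effect: as `[κ′ : κ] → ∞`, `λ_{κ′}(f; c) → 1` or lies in `{0, 2}`,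
   with limit `1` for generic `f` (Theorem 6.12, p. 38) — for this `f` over `𝔽_{3^m}` the odd-degree
   factor is `1 ± 2/((q−1)(q−2))` (`m` odd) or `1 + 2/((q−2)(q−3))` (`m` even), e.g. `22/21` over
   `𝔽₉` (Example 6.10), so prime-free degrees occur over `𝔽₃` only.

## References (read at the cited pages)

* B. Conrad, K. Conrad, R. Gross, *Prime specialization in genus 0*, Trans. AMS 360 (2008),
  2867–2908: §1 (Examples 1.1–1.2 and the three observations), §2 (2.5), §3 Examples 3.2–3.3
  ((3.6), (3.9)), §4 Theorem 4.8 (p. 15), §6 Definition 6.1, Conjecture 6.2, Remark 6.3 (p. 34),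
  Theorem 6.5, Examples 6.6, 6.9, 6.10 (pp. 36–37), Theorem 6.12 (p. 38) [ConradConradGross2008].
* A. Entin, *On the Bateman–Horn conjecture for polynomials over large finite fields*, Compositio
  Math. 152 (2016), 2525–2544 = arXiv:1409.0846: Theorem 1.1 and the paragraph after it ("The
  separability condition on the `F_i` generally cannot be omitted … See [CCG] and [Swan]") [Entin2016].
* W. Sawin, M. Shusterman, *On the Chowla and twin primes conjectures over `𝔽_q[T]`*, Ann. of
  Math. 196 (2022) = arXiv:1808.04001: Theorem 1.1 (twin primes, `q > 685090p²`), Theorem 1.3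
  (`k`-point Chowla, `q > p²k²e²`), p. 3 (the `μ(r + s^p)` observation and its relation to CCG
  Theorem 4.8) [SawinShusterman2018].
* W. Sawin, M. Shusterman, *Möbius cancellation on polynomial sequences and the quadratic
  Bateman–Horn conjecture over function fields*, Invent. Math. 229 (2022), 751–927 =
  arXiv:2008.09905: Conjecture 1.1 (separable `F`, naive `𝔖_q(F)`), Theorem 1.2, Theorem 1.3 and
  the sentence after it ("builds on and complements [CCG] which deals with certain squarefree
  inseparable polynomials `F`, for which [Chowla along `F`] is shown not to hold"), §1.2 proof overview
  (fixed-derivative subsums + Pellet's formula + a CCG-type resultant expression) [SawinShusterman2022].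
* R. G. Swan, Factorization of polynomials over finite fields, Pacific J. Math. 12 (1962),
  1099–1106 (the discriminant/parity theorem behind (2.5); `T⁸ + u³` over `𝔽₂`).
-/

noncomputable section

open Polynomial

namespace Literature.Barriers.Parity

/-- The Conrad–Conrad–Gross polynomial of Examples 1.2 / 3.3 / 6.10:
`f(T) = T⁹ + (2u² + u) T⁶ + (2u + 2) T³ + (u² + 2u + 1) ∈ 𝔽₃[u][T]`, as a polynomial in `T`
(outer variable) with coefficients in `𝔽₃[u] = Polynomial (ZMod 3)` (inner variable `u`). It is a
polynomial in `T³ = T^p`, the inseparable case in which Möbius periodicity occurs.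
[cite: ConradConradGross2008, Example 1.2] -/
def ccgPoly : Polynomial (Polynomial (ZMod 3)) :=
  X ^ 9 + C (2 * X ^ 2 + X) * X ^ 6 + C (2 * X + 2) * X ^ 3 + C (X ^ 2 + 2 * X + 1)

/-- Specialising `T ↦ g(u)`: `f(g) = g⁹ + (2u² + u) g⁶ + (2u + 2) g³ + u² + 2u + 1 ∈ 𝔽₃[u]`
(definition unfolding). [cite: ConradConradGross2008, Example 3.3] -/
theorem ccgPoly_eval (g : Polynomial (ZMod 3)) :
    ccgPoly.eval g =
      g ^ 9 + (2 * X ^ 2 + X) * g ^ 6 + (2 * X + 2) * g ^ 3 + (X ^ 2 + 2 * X + 1) := by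
  simp only [ccgPoly, eval_add, eval_mul, eval_pow, eval_C, eval_X]

/-- **Möbius (parity) bias in the function-field Bateman–Horn problem** (Conrad–Conrad–Gross,
Example 6.10, a theorem). Let `f(T) = T⁹ + (2u² + u)T⁶ + (2u + 2)T³ + u² + 2u + 1 ∈ 𝔽₃[u][T]`
(`ccgPoly`; prime in `𝔽₃[u][T]` and without local obstruction, so that the analogy with `ℤ[T]`
predicts `∼ C(f) · 2 · 3ⁿ/(9 n log 3)` prime values `f(g)`, `deg g = n`). Then `f(g)` is
composite in `𝔽₃[u]` for every `g ∈ 𝔽₃[u]` with `deg g ≡ 1 (mod 4)`. Printed proof: by (3.9),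
`μ(f(g)) = (−1)ⁿ χ(−1)^{n(n−1)/2} χ(c)^{n+1} χ(g(1)² + g(1) + 2) χ(g(2))` (`g = c uⁿ + …`,
`χ` the quadratic character of `𝔽₃`), and for `n ≡ 1 (mod 4)` this is `−1` only when
`(f(g), (u−1)(u−2)) ≠ 1`; a square-free `f(g)` with `μ = +1` has an even number `≥ 2` of prime
factors. Transcribed as `¬ Irreducible (f(g))` (`deg f(g) = 9 deg g > 1`, so `f(g)` is neither
zero nor a unit). [cite: ConradConradGross2008, Example 6.10] [cite: ConradConradGross2008, Example 3.3 (3.9)]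

BARRIER (D-0021; one line per key):
technique_class: bateman-horn-heuristic random-model moebius-randomness local-densities singular-series sieve-axioms-generic function-field-analogy function-field-pilot verbatim-transfer inseparable-specialization
blocks: any derivation of the Bateman–Horn asymptotic (tree `Literature.NumberTheory.Sieve.BatemanHornConjecture` / `Literature.NumberTheory.Sieve.BatemanHornAsymptotic`, and its `k = 1` cases such as `Literature.NumberTheory.Sieve.HardyLittlewoodConjE`) from inputs that hold VERBATIM for the prime `f = ccgPoly ∈ 𝔽₃[u][T]` (more generally for a prime INSEPARABLE `f ∈ κ[u][T^p]` without local obstruction over a finite field `κ`) — (i) irreducibility over `κ(u)`; (ii) absence of a fixed prime divisor (kernel-checked for `ccgPoly`: `ccgPoly_noLocalObstruction`, `isUnit_of_forall_dvd_ccgPoly_eval`); (iii) the local root counts `ω_f(v)`, i.e. the (convergent) singular series `C(f)`; (iv) Type-I / congruence equidistribution of the values, which over `κ[u]` is EXACT — for `d ≠ 0` with `deg d ≤ n` and any `r`, `#{g : deg g = n, g ≡ r (mod d)} = (q−1)q^{n−deg d}` by the division algorithm, so `#{g : deg g = n, d ∣ f(g)} = ρ_f(d)(q−1)q^{n−deg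 d}` with zero remainder up to level `q^n` (dimension-one sieve axioms at every level; folklore); (v) the "randomness" heuristic that a value free of local obstructions is prime with the density-corrected random probability — because for `ccgPoly` (i)–(iv) hold and the conclusion fails: NO prime values in degrees `n ≡ 1 (mod 4)` (this theorem), conjecturally twice the naive count in degrees `≡ 3 (mod 4)` (`Λ = 2`), and for `f ∈ κ[u][T^p]` in general the count deviates from the literal `κ[u]`-analogue ((6.3) without `Λ_κ(f; n)`) by the Möbius-average factor `Λ_κ(f; n) ∈ [0, 2]` (ratio `4/3`, `μ(f(g)) = −1` twice as often as `+1`, in Examples 1.1/3.2/6.9); equivalently, read as a litmus test for `ℤ`: a proof of `BatemanHorn` must use an input that FAILS for `ccgPoly` over `𝔽₃[u]` — none of (i)–(iv) does — and the known candidates are inputs tied to separability / characteristic `0` (`f′ ≢ 0`; bilinear decompositions along fixed-derivative families, evasion (c)) or to the archimedean place [cite: ConradConradGross2008, §1 (abstract, Examples 1.1–1.2)] [cite: ConradConradGross2008, Example 3.2 (3.6)] [cite: ConradConradGross2008, Example 6.10].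
because: over `κ[u]` the Möbius function is computed by a discriminant, `μ_{κ[u]}(h) = (−1)^{deg h} χ(disc_κ h)` for odd `p` (Swan; (2.5)) — "this has no known analogue for the Möbius function on `ℤ`" — and for `f ∈ κ[u][T^p]` one has `(f(g))′ = (∂_u f)(g)`, so `disc f(g)` is a resultant `R(f(g), (∂_u f)(g))` that is quasi-periodic in `g`; hence (Theorem 4.8) for `f ∈ κ[u][T^p]` square-free, `p` odd, there is `M ≠ 0` in `κ[u]` with `μ(f(g₁)) = μ(f(g₂))` whenever `g₁ ≡ g₂ mod M`, `deg g₁ ≡ deg g₂ mod 4` and the leading coefficients have the same quadratic character (degrees large); the non-zero values of `μ(f(g))` in a fixed degree are then a periodic pattern determined by `(g mod M, deg g mod 4, χ(lead g))` rather than a fair coin, and `μ(f(g)) = +1` excludes primality — "a fundamentally global obstruction", a "'parity' obstruction to prime values" invisible to the local factors of the conjecture; the pattern may be unbalanced (Example 1.1: `−1` twice as often as `+1`) or balanced but COUPLED to local data (the `f` of this entry: in each degree `n ≥ 1` the unconditioned non-zero values are equally often `±1`, `Λ_{κ,1}(f; n) = 1`, yet for `n ≡ 1 (mod 4)` one has `μ(f(g))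 = −1` only when `(f(g), (u−1)(u−2)) ≠ 1`, so every `f(g)` is composite for one of two reasons) [cite: ConradConradGross2008, §2 (2.5) and Theorem 2.3] [cite: ConradConradGross2008, Theorem 4.8] [cite: ConradConradGross2008, §1 (pp. 2–3)] [cite: ConradConradGross2008, Example 6.10 (p. 2903: `Λ_{κ,1}(f; n) = 1`)].
evasions_known: (a) correct the conjecture by the Möbius average — Conjecture 6.2 multiplies the naive asymptotic by `Λ_κ(f; n) = 1 − (∑ μ(f(g)))/(∑ |μ(f(g))|)` (sums over `deg g = n`, `(f(g), M_f^{min}) = 1`), a rational number in `[0, 2]` that is eventually periodic in `n` with period `1, 2` or `4` (Theorem 6.5); when `Λ_κ(f; n) = 0` the absence of prime values is proved, otherwise the corrected prediction is supported numerically but unproved [cite: ConradConradGross2008, Definition 6.1, Conjecture 6.2 and the discussion after it]; (b) SEPARABLE `f` are outside the class: the periodicity theorems need `f ∈ κ[u][T^p]` (resp. `κ[u][T⁴]` for `p = 2`, Theorem 5.12), and for `f` separable over `κ(u)` "we expect `f(g)` to be prime as often as analogies between `ℤ` and `κ[u]` predict" [cite: ConradConradGross2008, Remark 6.3] — by now PROVED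 in the large-`q` limit (for non-associate irreducible separable `F₁, …, F_m ∈ 𝔽_q[t][x]` monic in `x` and `n ≥ max(3, sl Fᵢ)`, `#{f : deg f = n, all Fᵢ(t, f) irreducible} = (∏ μᵢ/Nᵢ) q^{n+1}(1 + O_{m, deg Fᵢ, n}(q^{−1/2}))`, with "the separability condition on the `Fᵢ` generally cannot be omitted … see [CCG]") [cite: Entin2016, Theorem 1.1 and the remark after it] and at FIXED `q` in degree `≤ 2`: the twin-prime asymptotic `#{f : |f| = X, f, f + h prime} ∼ 𝔖_q(h) X/log_q² X` for `p` odd, `q > 685090 p²` [cite: SawinShusterman2018, Theorem 1.1], the quadratic Bateman–Horn conjecture with the NAIVE singular series `𝔖_q(F)` for irreducible separable monic `F` of `T`-degree `2`, `p` odd, `q > 2¹⁰3²e²p⁴` [cite: SawinShusterman2022, Conjecture 1.1 and Theorem 1.2], and Chowla along polynomial values, `∑_{|f| ≤ X} μ(F(f)) = o(X)` for every separable `F ∈ 𝔽_q[u][T]` of degree `k`, `q > 4e²k²p²`, which "builds on and complements [CCG] which deals with certain squarefree inseparable polynomials `F`, for which [it] is shown not to hold" [cite: SawinShusterman2022, Theorem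 1.3]; (c) the mechanism of this entry is itself the lever of those proofs: Sawin–Shusterman restrict to fixed-derivative families `f = r + s^p`, on which "`μ(r + s^p)` essentially equals `χ_{D_r}(s + c_r)` where `χ_{D_r}` is a quadratic Dirichlet character … very closely related to … [CCG08, Theorem 4.8]" — in substance CCG periodicity for the polynomial `F(r + S^p) ∈ κ[u][S^p]` — and then win by cancellation in short character sums plus a level of distribution beyond `1/2` [cite: SawinShusterman2018, §1.2 (p. 3) and Abstract] [cite: SawinShusterman2022, §1.2 (proof overview: fixed-derivative subsums, Pellet's formula, CCG-type resultant expression)]; so Möbius periodicity along the cosets `r + κ[u]^p` holds for EVERY `F` and is an asset, and only for inseparable `f` (all of `κ[u]` a single coset) does the bias survive averaging; (d) in characteristic `2` other inseparable `f` (e.g. `T² + u` over `𝔽₂[u]`) numerically fit the naive conjecture [cite: ConradConradGross2008, §6 (before Remark 6.3)].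
scope_caveats: (a) this is a theorem about `κ[u]`, not about `ℤ`: every `f ∈ ℤ[T]` is separable and no discriminant formula or periodicity for `μ` on `ℤ` is known ("no known analogue"), so the result refutes only the VERBATIM transfer of the local-plus-Type-I heuristic (and any proof strategy insensitive to the difference between `ℤ` and `κ[u][T^p]`), not Bateman–Horn itself, and not the transfer of STRUCTURE proved over `𝔽_q[u]` for separable data (evasions (b)–(c)) [cite: ConradConradGross2008, §2 (after Definition 2.1)] [cite: ConradConradGross2008, Remark 6.3]; (b) generically a small-field effect: as `[κ′ : κ] → ∞` the eventual values `λ_{κ′}(f; c)` tend to `1` or lie in `{0, 2}`, and tend to `1` for generic `f` (some odd local intersection number of `Z_f ∩ Z_{∂ᵤf}`); for the `f` of this entry over `𝔽_{3^m}`, `Λ = 1` for even `n` and `1 + 2(−1)^{(n+1)/2}/((q−1)(q−2))` (`m` odd) resp. `1 + 2/((q−2)(q−3))` (`m` even) for odd `n` — `0, 1, 2, 1, …` over `𝔽₃` but `22/21` (odd `n`) over `𝔽₉` — so prime-free degrees occur over `𝔽₃` only, while the rigid values `{0, 2}` do occur in other families (`Λ_{𝔽₃}(T³ + u; n) = 1,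 2, 1, 0, …`, Example 6.6) [cite: ConradConradGross2008, Theorem 6.12] [cite: ConradConradGross2008, Example 6.10] [cite: ConradConradGross2008, Example 6.6]; (c) the link between `Λ_κ(f; n) ≠ 0` and the prime counts is conjectural ("we have not proved a connection … but (6.3) agrees well with the extensive numerical testing"); in particular the factor `2` in degrees `≡ 3 (mod 4)` is numerical, only the `0` is proved [cite: ConradConradGross2008, §6 (after Conjecture 6.2)]; (d) transcription: Example 6.10's compositeness statement is the Lean content and is PROVED (`FunctionFieldMobiusBias_holds`, for every `n ≡ 1 (mod 4)`, `n ≥ 1`, matching the range `n ≥ 1` of (6.4)); the absence of a fixed prime divisor is PROVED below; primality of `f` in `𝔽₃[u][T]`, Theorem 4.8, Conjecture 6.2, the `Λ`-values and the exact Type-I count of `blocks` (iv) are quoted in prose, and Mathlib has no Möbius function on `κ[u]` with which to state (3.9) directly [cite: ConradConradGross2008, Example 1.2]; (e) audit 2026-08-16: technique class narrowed (bare token `transfer` replaced by `verbatim-transfer`; the separable function-field analogy is not in the class), bite widened to Type-I data, literature evasions (b)–(c) recorded; (f) companion audit of the proof file, same day: the NARROWED record `Literature.Barriers.Parity.FunctionFieldMobiusBiasNarrow`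 (in `FunctionFieldMobiusBiasProofs.lean`, PROVED there) makes the `f`-UNIFORM reading of `blocks` explicit — the `k = 1` target `HardyLittlewoodConjE` is bitten only through arguments uniform in `f`, since `T² + 1` is never an inseparable irreducible (kernel-checked) and the naive `𝔽_q[u]`-asymptotic for prime values of `g² + 1` is an instance of evasion (b) (`deg_T F = 2`, `q ≡ 3 (mod 4)`, `q > 2¹⁰3²e²p⁴`) — and adds a second kernel-checked instance at the RIGID end of caveat (b): `g³ + u` is composite for `4 ∣ deg g > 0` over `𝔽₃[u]` (Example 2.5; `λ ∈ {0, 2}` over every extension, Theorem 6.12), plus `∂_T ccgPoly = 0` [cite: ConradConradGross2008, Example 2.5] [cite: SawinShusterman2022, Theorem 1.2].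
status: established — PROVED in tree (`Literature.Barriers.Parity.FunctionFieldMobiusBias_holds`, file `FunctionFieldMobiusBiasProofs.lean`) [cite: ConradConradGross2008, Example 6.10] -/
def FunctionFieldMobiusBias : Prop :=
  ∀ g : Polynomial (ZMod 3), g.natDegree % 4 = 1 → ¬ Irreducible (ccgPoly.eval g)

/-- `FunctionFieldMobiusBias` with `f(g)` written out:
`g⁹ + (2u² + u)g⁶ + (2u + 2)g³ + u² + 2u + 1` is reducible for `deg g ≡ 1 (mod 4)`.
[cite: ConradConradGross2008, Example 6.10] -/
theorem FunctionFieldMobiusBias.explicit (h : FunctionFieldMobiusBias) (g : Polynomial (ZMod 3))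
    (hg : g.natDegree % 4 = 1) :
    ¬ Irreducible (g ^ 9 + (2 * X ^ 2 + X) * g ^ 6 + (2 * X + 2) * g ^ 3 + (X ^ 2 + 2 * X + 1)) :=
  ccgPoly_eval g ▸ h g hg

/-! ### The naive hypothesis "no local obstruction" holds verbatim (audit 2026-08-16) -/

/-- `3 = 0` in `𝔽₃[u]`. [folklore] -/
theorem three_eq_zero_polynomial_zmod3 : (3 : Polynomial (ZMod 3)) = 0 := by
  rw [← map_ofNat C 3, show (3 : ZMod 3) = 0 from by decide, map_zero]

/-- **No local obstruction for `ccgPoly`, Bezout form**: `f(0) = (u + 1)²` and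
`f(1) = 2u + 1 = 2(u − 1)` are coprime in `𝔽₃[u]` — indeed `f(0) + u · f(1) = 1` — so the values
`f(g)`, `g ∈ 𝔽₃[u]`, "do not all share a nontrivial common factor" (CCG's definition of "no local
obstruction", §1), which is the Bateman–Horn hypothesis "no fixed prime divisor" transferred
verbatim. This makes kernel-checked the premise, quoted in prose in Example 1.2 / 6.10, under which
the naive analogue of Bateman–Horn predicts `≍ 3ⁿ/n` prime values in every degree.
[cite: ConradConradGross2008, §1 (definition of local obstruction) and Example 1.2] -/
theorem ccgPoly_noLocalObstruction : IsCoprime (ccgPoly.eval 0) (ccgPoly.eval 1) := by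
  refine ⟨1, X, ?_⟩
  simp only [ccgPoly_eval]
  calc _ = 1 + 3 * (X ^ 3 + 2 * X ^ 2 + 2 * X) := by ring
    _ = 1 := by rw [three_eq_zero_polynomial_zmod3, zero_mul, add_zero]

/-- **No fixed divisor**: a polynomial `d ∈ 𝔽₃[u]` dividing every value `f(g)` of `ccgPoly` is a
unit — the hypothesis "`ω(p) < p` for all `p`" / "no fixed prime divisor" of `BatemanHorn` holds
word for word for the function-field example, although the conclusion fails in degrees
`≡ 1 (mod 4)` (`FunctionFieldMobiusBias`). [cite: ConradConradGross2008, Example 1.2] -/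
theorem isUnit_of_forall_dvd_ccgPoly_eval {d : Polynomial (ZMod 3)}
    (hd : ∀ g : Polynomial (ZMod 3), d ∣ ccgPoly.eval g) : IsUnit d :=
  ccgPoly_noLocalObstruction.isUnit_of_dvd' (hd 0) (hd 1)

end Literature.Barriers.Parity
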